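import Summits.Ventures.DiscreteObjects.Hadamard.PlugIns668

/-!
# Skew Hadamard matrices of order 668 from the Goethals–Seidel array: ONE skew-type block suffices (kernel plug-in)

Framing: lottery ticket; floor = certified bounds/negative ranges.  Cell pub-namedobj (venture DiscreteObjects),
target (H), hadamard gen 27.  A skew Hadamard matrix is a Hadamard matrix `H` with `H + Hᵀ = 2I`; a skew `H(668)` is NOT
known (Seberry–Yamada 2020 Table 9.2: for `q = 167` the least `t` with a known skew `H(2ᵗ·167)` is `t = 9`), and 'good
matrices' of order `167` (one skew-type + three symmetric circulants; gen 26 `SkewTypeRows668` typed their row sums) are the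
classical route.  This file proves the plug-in in the kernel and records that, in the Goethals–Seidel array, the symmetry of
the other three blocks is NOT needed:
* **`gsMatrix_add_transpose_apply`** (any finite abelian group `G`, any commutative ring): the Goethals–Seidel array is
  automatically 'amicable off the diagonal' — `(GS + GSᵀ)((p,i),(q,j)) = [p = q]·(a(i − j) + a(j − i))`: every off-diagonal
  block of `GS` is the negative transpose of its mirror block, because `X R` and `Xᵀ R` are symmetric for circulant `X`;
* **`gsMatrix_skew_of_skewType`**: if `a 0 = 1` and `a(−x) = −a(x)` for `x ≠ 0` (skew-type first block; `b, c, d` ARBITRARY)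
  then `GS + GSᵀ = 2·I`;
* **`skewHadamard_of_skewType_gsQuad`** (`ZMod n`): four `±1` sequences with `Σ PAF = 0` off `0` and `a` skew-type with
  `a 0 = 1` give a SKEW Hadamard matrix of order `4n`; **`skewHadamard668_of_skewType_gsQuad167`** — so the census family for
  a skew `H(668)` is 'GS quadruples over `ZMod 167` with one skew-type block' (row sums typed by gen 26:
  `{|Σb|,|Σc|,|Σd|} ∈ {{21,15,1},{19,15,9}}`, `Σa = a 0 = 1`), strictly larger than good matrices;
* `(+)` CONTROLS by kernel evaluation: **`skewHadamard12_control`** (`v = 3`: `a = b = c = (1,1,−1)` skew-type — `b, c` NOT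
  symmetric — `d = (1,1,1)`) and **`skewHadamard28_control`** (`v = 7`: `a = b = c = χ₇′`, `d = J − 2δ₀`).
WORDS: plug-in about hypothetical objects; no order excluded; skew `H(668)`, `H(668)` untouched.  Ours; no `sorry`.
-/

namespace Summit.Ventures.DiscreteObjects.Hadamard

open Finset BigOperators Matrix

open Literature.Combinatorics.Designs.GoethalsSeidel (IsHadamardMatrix gsMatrix gsBlocks goethalsSeidel_isHadamard bcirc bcircT
  circT bcirc_apply bcircT_apply circT_apply transpose_bcirc transpose_bcircT)
open Literature.Combinatorics.Designs.LegendrePairs (PAF IsPM)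

section general
variable {G : Type*} [AddCommGroup G] [Fintype G] [DecidableEq G] {α : Type*} [CommRing α]

omit [Fintype G] [DecidableEq G] in
/-- **block transposes of the Goethals–Seidel array**: the mirror of an off-diagonal block is its negative transpose, the
diagonal blocks transpose to `circT a` — for ARBITRARY `b, c, d` (because `X R` and `Xᵀ R` are symmetric for circulant `X`). -/
theorem gsBlocks_transpose (a b c d : G → α) (p q : Fin 4) :
    (gsBlocks a b c d q p)ᵀ = if p = q then circT a else -gsBlocks a b c d p q := by
  fin_cases p <;> fin_cases q <;>
    simp [gsBlocks, transpose_bcirc, transpose_bcircT, Matrix.transpose_neg, circT]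

omit [Fintype G] [DecidableEq G] in
/-- the diagonal blocks are `circulant a`. -/
lemma gsBlocks_diag (a b c d : G → α) (p : Fin 4) : gsBlocks a b c d p p = circulant a := by
  fin_cases p <;> rfl

omit [Fintype G] [DecidableEq G] in
/-- **The Goethals–Seidel array is amicable off the diagonal**: `(GS + GSᵀ)((p,i),(q,j)) = [p = q]·(a(i − j) + a(j − i))` —
the off-diagonal blocks cancel against the transposes of their mirror blocks for ARBITRARY `b, c, d`. -/
theorem gsMatrix_add_transpose_apply (a b c d : G → α) (p q : Fin 4) (i j : G) :
    (gsMatrix a b c d + (gsMatrix a b c d)ᵀ) (p, i) (q, j) = if p = q then a (i - j) + a (j - i) else 0 := by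
  have h := congrFun (congrFun (gsBlocks_transpose a b c d p q) i) j
  rw [Matrix.transpose_apply] at h
  rw [Matrix.add_apply, Matrix.transpose_apply]
  simp only [gsMatrix, Matrix.of_apply]
  rw [h]
  by_cases hpq : p = q
  · subst hpq
    rw [if_pos rfl, if_pos rfl, gsBlocks_diag, Matrix.circulant_apply, circT_apply]
  · rw [if_neg hpq, if_neg hpq, Matrix.neg_apply, add_neg_cancel]

omit [Fintype G] in
/-- **one skew-type block makes the Goethals–Seidel array skew**: if `a 0 = 1` and `a(−x) = −a(x)` for `x ≠ 0` then
`GS + GSᵀ = 2·I`, whatever `b, c, d` are. -/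
theorem gsMatrix_skew_of_skewType (a b c d : G → α) (h0 : a 0 = 1) (hskew : ∀ x, x ≠ 0 → a (-x) = -a x) :
    gsMatrix a b c d + (gsMatrix a b c d)ᵀ = (2 : α) • (1 : Matrix (Fin 4 × G) (Fin 4 × G) α) := by
  ext ⟨p, i⟩ ⟨q, j⟩
  rw [gsMatrix_add_transpose_apply, Matrix.smul_apply, Matrix.one_apply, smul_eq_mul]
  by_cases hpq : p = q
  · subst hpq
    by_cases hij : i = j
    · subst hij; rw [if_pos rfl, if_pos rfl, sub_self, h0]; ring
    · have hne : i - j ≠ 0 := sub_ne_zero.mpr hij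
      have e : j - i = -(i - j) := by abel
      rw [if_pos rfl, e, hskew _ hne, if_neg (fun h => hij (Prod.mk.inj h).2)]; ring
  · rw [if_neg hpq, if_neg (fun h => hpq (Prod.mk.inj h).1), mul_zero]

end general

section sequences
variable {n : ℕ} [NeZero n]

/-- **Skew Hadamard matrices from a GS quadruple with one skew-type block** (order `4n`): four `±1` sequences on `ZMod n` with
autocorrelations summing to `0` off `0`, the first skew-type with `a 0 = 1`, give a Hadamard matrix `H` of order `4n` with
`H + Hᵀ = 2I`. -/
theorem skewHadamard_of_skewType_gsQuad (a b c d : ZMod n → ℤ) (ha : IsPM a) (hb : IsPM b) (hc : IsPM c) (hd : IsPM d)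
    (hs : ∀ s : ZMod n, s ≠ 0 → PAF a s + PAF b s + PAF c s + PAF d s = 0) (h0 : a 0 = 1)
    (hskew : ∀ x, x ≠ 0 → a (-x) = -a x) :
    IsHadamardMatrix (gsMatrix a b c d) ∧
      gsMatrix a b c d + (gsMatrix a b c d)ᵀ = (2 : ℤ) • (1 : Matrix (Fin 4 × ZMod n) (Fin 4 × ZMod n) ℤ) ∧
      Fintype.card (Fin 4 × ZMod n) = 4 * n :=
  ⟨goethalsSeidel_isHadamard a b c d ha hb hc hd hs, gsMatrix_skew_of_skewType a b c d h0 hskew, by simp [ZMod.card]⟩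

/-- **Census family for a skew `H(668)`**: a GS quadruple over `ZMod 167` whose first block is skew-type (`a 0 = 1`,
`a(−x) = −a(x)`; `b, c, d` arbitrary `±1` rows) gives a SKEW Hadamard matrix of order `668`. -/
theorem skewHadamard668_of_skewType_gsQuad167 (a b c d : ZMod 167 → ℤ) (hq : GSQuad a b c d) (h0 : a 0 = 1)
    (hskew : ∀ x, x ≠ 0 → a (-x) = -a x) :
    IsHadamardMatrix (gsMatrix a b c d) ∧
      gsMatrix a b c d + (gsMatrix a b c d)ᵀ = (2 : ℤ) • (1 : Matrix (Fin 4 × ZMod 167) (Fin 4 × ZMod 167) ℤ) ∧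
      Fintype.card (Fin 4 × ZMod 167) = 668 :=
  ⟨(skewHadamard_of_skewType_gsQuad a b c d hq.1 hq.2.1 hq.2.2.1 hq.2.2.2.1 hq.2.2.2.2 h0 hskew).1,
    gsMatrix_skew_of_skewType a b c d h0 hskew, by simp [ZMod.card]⟩

/-- **(+) control, `v = 3`**: `a = b = c = (1, 1, −1)` (skew-type; note that `b, c` are NOT symmetric) and `d = (1, 1, 1)` give a
skew Hadamard matrix of order `12`. -/
theorem skewHadamard12_control :
    ∃ a d : ZMod 3 → ℤ, IsPM a ∧ IsPM d ∧ (∀ s : ZMod 3, s ≠ 0 → PAF a s + PAF a s + PAF a s + PAF d s = 0) ∧ a 0 = 1 ∧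
      (∀ x : ZMod 3, x ≠ 0 → a (-x) = -a x) ∧ ¬ (∀ x : ZMod 3, a (-x) = a x) ∧
      IsHadamardMatrix (gsMatrix a a a d) ∧
      gsMatrix a a a d + (gsMatrix a a a d)ᵀ = (2 : ℤ) • (1 : Matrix (Fin 4 × ZMod 3) (Fin 4 × ZMod 3) ℤ) ∧
      Fintype.card (Fin 4 × ZMod 3) = 12 := by
  have ha : IsPM (fun i : ZMod 3 => if i = 2 then (-1 : ℤ) else 1) := by unfold IsPM; decide
  have hd : IsPM (fun _ : ZMod 3 => (1 : ℤ)) := fun _ => Or.inl rfl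
  have hs : ∀ s : ZMod 3, s ≠ 0 → PAF (fun i : ZMod 3 => if i = 2 then (-1 : ℤ) else 1) s +
      PAF (fun i : ZMod 3 => if i = 2 then (-1 : ℤ) else 1) s + PAF (fun i : ZMod 3 => if i = 2 then (-1 : ℤ) else 1) s +
      PAF (fun _ : ZMod 3 => (1 : ℤ)) s = 0 := by decide
  have h0 : (fun i : ZMod 3 => if i = 2 then (-1 : ℤ) else 1) 0 = 1 := by decide
  have hskew : ∀ x : ZMod 3, x ≠ 0 → (fun i : ZMod 3 => if i = 2 then (-1 : ℤ) else 1) (-x) =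
      -(fun i : ZMod 3 => if i = 2 then (-1 : ℤ) else 1) x := by decide
  obtain ⟨hH, hsk, hcard⟩ := skewHadamard_of_skewType_gsQuad _ _ _ _ ha ha ha hd hs h0 hskew
  exact ⟨_, _, ha, hd, hs, h0, hskew, by decide, hH, hsk, hcard⟩

/-- **(+) control, `v = 7`**: `a = b = c = χ₇′ = (1,1,1,−1,1,−1,−1)` (skew-type, `PAF = −1`) and `d = J − 2δ₀` (`PAF = 3`) give a
skew Hadamard matrix of order `28`. -/
theorem skewHadamard28_control :
    ∃ a d : ZMod 7 → ℤ, IsPM a ∧ IsPM d ∧ (∀ s : ZMod 7, s ≠ 0 → PAF a s + PAF a s + PAF a s + PAF d s = 0) ∧ a 0 = 1 ∧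
      (∀ x : ZMod 7, x ≠ 0 → a (-x) = -a x) ∧ IsHadamardMatrix (gsMatrix a a a d) ∧
      gsMatrix a a a d + (gsMatrix a a a d)ᵀ = (2 : ℤ) • (1 : Matrix (Fin 4 × ZMod 7) (Fin 4 × ZMod 7) ℤ) ∧
      Fintype.card (Fin 4 × ZMod 7) = 28 := by
  have ha : IsPM (fun i : ZMod 7 => if i = 3 ∨ i = 5 ∨ i = 6 then (-1 : ℤ) else 1) := by unfold IsPM; decide
  have hd : IsPM (fun i : ZMod 7 => if i = 0 then (-1 : ℤ) else 1) := by unfold IsPM; decide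
  have hs : ∀ s : ZMod 7, s ≠ 0 → PAF (fun i : ZMod 7 => if i = 3 ∨ i = 5 ∨ i = 6 then (-1 : ℤ) else 1) s +
      PAF (fun i : ZMod 7 => if i = 3 ∨ i = 5 ∨ i = 6 then (-1 : ℤ) else 1) s +
      PAF (fun i : ZMod 7 => if i = 3 ∨ i = 5 ∨ i = 6 then (-1 : ℤ) else 1) s +
      PAF (fun i : ZMod 7 => if i = 0 then (-1 : ℤ) else 1) s = 0 := by decide
  have h0 : (fun i : ZMod 7 => if i = 3 ∨ i = 5 ∨ i = 6 then (-1 : ℤ) else 1) 0 = 1 := by decide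
  have hskew : ∀ x : ZMod 7, x ≠ 0 → (fun i : ZMod 7 => if i = 3 ∨ i = 5 ∨ i = 6 then (-1 : ℤ) else 1) (-x) =
      -(fun i : ZMod 7 => if i = 3 ∨ i = 5 ∨ i = 6 then (-1 : ℤ) else 1) x := by decide
  obtain ⟨hH, hsk, hcard⟩ := skewHadamard_of_skewType_gsQuad _ _ _ _ ha ha ha hd hs h0 hskew
  exact ⟨_, _, ha, hd, hs, h0, hskew, hH, hsk, hcard⟩

end sequences

end Summit.Ventures.DiscreteObjects.Hadamard
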